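import Summits.BirchSwinnertonDyer.BirchSwinnertonDyer.Theorems.ClassRecordThreeCornerAtThreeShimuraWalkDefs
import Summits.BirchSwinnertonDyer.BirchSwinnertonDyer.Theorems.ClassRecordThreeCornerTwinHalvesDefs
import Literature.NumberTheory.NumberFields.RingClassFieldOfConductor
import HarnessLib

/-!
# Crux `CornerAtThreeW` (item stmt-BirchSwinnertonDyer-21420) — the two r23 ITEM STATEMENTS restated in a module with NO `Theses.*` import
# (plan g43 RULING 80 (b); cell `bsd-stepL`, seat `bsd-stepL-corner3-p2` g16; `--kind definition --supports stmt-BirchSwinnertonDyer-21420 --as helper`)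

WHY. RULING 80 (a) files the six open sub-goals of 21420's line r22 as CHILDREN of `CornerAtThreeW` (three cruxes, three cite-only supports + glue),
so that r23 of `Cruxes/CornerAtThreeW/Lines/inert.lean` is the ZERO-STUB composition over items BY NAME (closer `CornerAtThreeWOfInputs.cornerAtThreeW_of_itemsR22K`,
p665549 + p667259). The route file must be able to `import` the module declaring each child's body and that module may import NO route file. Two of
the six bodies live in modules INSIDE the Theses cone — `ShimuraWalk.PrimitivesWithSplitNormTDAtThree` (`…CornerAtThreeShimuraSplitAuxNormDefs`, which
imports `Theses.KolyvaginRoadThree` via `…ShimuraWalkE0PrimeTDDefs`) and `CornerTwinHalves.CornerTwinLowerModEight` (`…CornerTwinLowerModEightDefs`, which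
imports both @3 route files via `…UpperModEightConsumed`). THIS MODULE re-states them VERBATIM over Theses-free modules only (`…ShimuraWalkDefs` for
`ShimuraWalk.LabelsAt`, `…CornerTwinHalvesDefs` for `CornerTwinHalves.IsTwinFrame`, `Literature.…RingClassFieldOfConductor`; import closure checked:
no `Summits.….Theses.*` module): `R23Items.SplitNormAt` (needed by the first body, also a verbatim copy), `R23Items.PrimitivesWithSplitNormTDAtThree`,
`R23Items.CornerTwinLowerModEightAt`, `R23Items.CornerTwinLowerModEight`. Each is DEFINITIONALLY EQUAL to its original (same term after δ-unfolding), so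
the r23 `_of` hands the item hypotheses to the closer unchanged (bridges `Iff.rfl` live in the cone files that see both names).

HONEST FRAMING: four `def … : Prop` COPIES of already-typed open objects (no new notion, no named fact minted, no theorem, no `sorry`); nothing is
asserted about any curve; item 21420 is not advanced by this file; no census word, tier or label moves (T7). BSD is proved for no curve.
References: [Darmon2004] Prop. 3.10, Def. 3.12, Thm. 4.18; [GrossLMS1991] §3 Prop. 3.7 (1); [Cox2013] §7.C Prop. 7.22; [HoffsteinLuo1997] Theorem (§1);
[Skinner2016PacificMC] Thm. C (shape only); [Miller2011LMS] Def. 1.1; tree originals: `…CornerAtThreeShimuraSplitAuxNormDefs` (lane B g14, p642549),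
`…CornerTwinLowerModEightDefs` (lane B g6, p585727).
-/

set_option autoImplicit false
set_option linter.dupNamespace false

noncomputable section

open scoped Classical NumberField Pointwise

open WeierstrassCurve NumberField IsDedekindDomain Literature.NumberTheory.EllipticCurves
  Literature.NumberTheory.EllipticCurves.ModularForms Literature.NumberTheory.Automorphic CongruenceSubgroup
  Literature.NumberTheory.NumberFields Literature.NumberTheory.NumberFields.RingClassField
  Literature.NumberTheory.EllipticCurves.Rank1Residual
  Summit.BirchSwinnertonDyer.Rank1Residual Summit.BirchSwinnertonDyer.Rank1Residual.X11b
  Summit.BirchSwinnertonDyer.BirchSwinnertonDyer.Theorems.ShimuraWalk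
  Summit.BirchSwinnertonDyer.BirchSwinnertonDyer.Theorems.CornerTwinHalves

namespace Summit.BirchSwinnertonDyer.BirchSwinnertonDyer.Theorems.R23Items

/-! ### §1 (a) — the printed CM-point primitives of `X_{N⁺,N⁻}` at `3` with the split-prime distribution relation (verbatim copies) -/

/-- VERBATIM COPY of `ShimuraWalk.SplitNormAt` (`…CornerAtThreeShimuraSplitAuxNormDefs`, lane B g14 p642549) over Theses-free imports —
**(B4-split), the split-prime distribution relation of a CM family at a PRINCIPAL split auxiliary prime**: for a square-free level `m` and a prime
`ℓ₀ ∣ m` with `ℓ₀ ∤ N`, `ℓ₀` SPLIT in `K`, the other prime factors of `m` prime to `N` and inert in `K`, both primes of `K` above `ℓ₀` of trivial class in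
the ring class group of conductor `m/ℓ₀`, and `σ` a generator of `Gal(K[m]/K[m/ℓ₀])`: `∑_{i < ℓ₀ − 1} σ^i (ys m) = (a_{ℓ₀}(E) − 2) • ys (m/ℓ₀)` — Darmon 2004
Prop. 3.10, split case, read at `σ_λ = 1`. A predicate on the family; nothing asserted; definitionally equal to the original.
[cite: Darmon2004, Prop. 3.10, Def. 3.12, Thm. 4.18] [cite: GrossLMS1991, §3 Prop. 3.7 (1) (inert template)] [cite: Cox2013, §7.C Prop. 7.22] -/
def SplitNormAt (W : WeierstrassCurve ℚ) [W.IsElliptic] [W.IsGloballyMinimal] (N : ℕ) (K : Type) [Field K] [NumberField K]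
    (ι : K →+* ℂ) (ys : (m : ℕ) → (W.baseChange (ringClassField K ι m)).toAffine.Point) : Prop :=
  ∀ m : ℕ, Squarefree m → ∀ (ℓ₀ : ℕ) (_ : ℓ₀ ∈ m.primeFactors), ¬ ℓ₀ ∣ N →
    ((Ideal.span {(ℓ₀ : ℤ)}).primesOver (𝓞 K)).ncard = 2 →
    (∀ r ∈ (m / ℓ₀).primeFactors, ¬ r ∣ N ∧ (Ideal.span {(r : 𝓞 K)}).IsPrime) →
    (∀ v : HeightOneSpectrum (𝓞 K), ((ℓ₀ : ℕ) : 𝓞 K) ∈ v.asIdeal → primeClass (m / ℓ₀) v = 1) →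
    ∀ (hle : ringClassField K ι (m / ℓ₀) ≤ ringClassField K ι m)
      (σ : ringClassField K ι m ≃ₐ[ℚ] ringClassField K ι m),
      Subgroup.zpowers σ = ringClassGalOver ι m (m / ℓ₀) →
      letI : Algebra K ℂ := ι.toAlgebra
      ∑ i ∈ Finset.range (ℓ₀ - 1), pointGalHom W (ringClassField K ι m) (σ ^ i) (ys m) =
        (W.frobeniusTrace ℓ₀ - 2) • WeierstrassCurve.Affine.Point.map (W' := W)
          ((RingClassField.inclusion ι hle).restrictScalars ℚ) (ys (m / ℓ₀))

/-- VERBATIM COPY of `ShimuraWalk.PrimitivesWithSplitNormTDAtThree` (`…CornerAtThreeShimuraSplitAuxNormDefs`, lane B g14 p642549; = the REGISTERED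
`stub_upper3_residualMulti` of `Cruxes/CornerAtThreeW/Lines/inert.lean` r20–r22 = RULING 80 child #3 `ShimuraPrimitivesWithSplitNormTDAtThree`) over
Theses-free imports, with `SplitNormAt` read as the copy above — **(a): the printed CM-point primitives of `X_{N⁺,N⁻}` at `3 ∈ S`** (Gross–Zagier display,
degree-valuation link, the labelled family `ShimuraWalk.LabelsAt` (B1)–(B5)) **WITH the split-prime distribution relation (B4-split)** at principal split
auxiliary primes. PRINT-LEVEL by statement (Darmon 2004 Prop. 3.10 ∕ Def. 3.12 ∕ Thm. 4.18 for the CM family of `X_{N⁺,N⁻}`; Cai–Shu–Tian 2014 Thm. 1.5;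
Nekovář 2007). A `Prop` constant; OPEN as typed; nothing asserted; definitionally equal to the original.
[cite: Darmon2004, Prop. 3.10, Def. 3.12, Thm. 4.18] [cite: CaiShuTian2014, Thm. 1.5 and special case 1] [cite: Nekovar2007, Thm. 3.2, (4.8), (4.9)] -/
@[conjecture]
def PrimitivesWithSplitNormTDAtThree : Prop :=
    ∀ (W : WeierstrassCurve ℚ) [W.IsElliptic] [W.IsGloballyMinimal] (N : ℕ)
    [NeZero N] (K : Type) [Field K] [NumberField K] (S : Finset ℕ)
    (Dt : Literature.NumberTheory.EllipticCurves.ModularForms.ModularParametrizationData W N)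
    (X : Literature.NumberTheory.Automorphic.ShimuraCurveData (∏ q ∈ S, q) (N / ∏ q ∈ S, q))
    (W' : WeierstrassCurve ℚ) [W'.IsElliptic]
    (P₀ : Literature.NumberTheory.Automorphic.ShimuraParametrizationData X W'),
    W.conductorNorm ℤ = N → W.HasIrreducibleModPGaloisRep 3 →
    ∀ (hK : Literature.NumberTheory.EllipticCurves.IsImaginaryQuadratic K), NumberField.discr K < -4 → Even S.card →
    (∀ ℓ ∈ S, ℓ.Prime ∧ ℓ ∣ N ∧ ¬ ℓ ^ 2 ∣ N ∧
      ((Ideal.span {(ℓ : ℤ)}).primesOver (NumberField.RingOfIntegers K)).ncard = 1 ∧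
      ¬ (ℓ : ℤ) ∣ NumberField.discr K) →
    (∀ ℓ : ℕ, ℓ.Prime → ℓ ∣ N → ℓ ∉ S →
      ((Ideal.span {(ℓ : ℤ)}).primesOver (NumberField.RingOfIntegers K)).ncard = 2) →
    3 ∈ S → ¬ (3 : ℤ) ∣ Dt.c → P₀.IsMinimalFor W →
    ∃ (ι : K →+* ℂ) (y : (W.baseChange K).toAffine.Point) (degy : ℕ)
      (ys : (m : ℕ) → (W.baseChange (Literature.NumberTheory.EllipticCurves.ringClassField K ι m)).toAffine.Point) (ε : ℤ), 0 < degy ∧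
      padicValNat 3 degy = padicValNat 3 P₀.deg ∧
      Literature.NumberTheory.EllipticCurves.LDerivEK W K = 8 * (Real.pi : ℂ) ^ 2 *
        Literature.NumberTheory.EllipticCurves.ModularForms.peterssonProduct (CongruenceSubgroup.Gamma0 N) 2
          Dt.f Dt.f / ((((NumberField.Units.torsionOrder K : ℝ) / 2) ^ 2 * √|(NumberField.discr K : ℝ)| : ℝ) : ℂ) *
        ((y.canonicalHeight : ℂ) / (degy : ℂ)) ∧
      (¬ IsOfFinAddOrder y → 0 < (AddSubgroup.zmultiples y).index) ∧ LabelsAt W N K ι y ys ε ∧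
      SplitNormAt W N K ι ys

/-! ### §2 The mod-8 twin-lower witness (verbatim copies) -/

/-- VERBATIM COPY of `CornerTwinHalves.CornerTwinLowerModEightAt` (`…CornerTwinLowerModEightDefs`, lane B g6 p585727) over Theses-free imports — **F1′ at a
`d_K ≡ 1 (mod 8)` frame**: for `W/ℚ` globally minimal with `(E,3) ∈` X11b and `ρ̄_{E,3}` NOT surjective there is SOME odd Heegner twin frame
(`CornerTwinHalves.IsTwinFrame`: `K` imaginary quadratic, `d_K` odd, `d_K < −4`, Heegner for `N(E)` and for `3`, `L(E^{(d_K)},1) ≠ 0`, a global minimal model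
`Wd = Cd • E^{(d_K)}`) WITH `d_K ≡ 1 (mod 8)` and a rational `q = L(Wd,1)/Ω(Wd)` carrying the twin's `≥`-half
`ord₃ q ≤ ord₃ #Ш(Wd) + ord₃ ∏c(Wd) − 2·ord₃ #tors(Wd)` (FREE at an exact twin). A predicate on `W`; OPEN as typed; nothing asserted; definitionally equal to the original.
UNTAGGED (plan g42 RULING 75 ∕ plan g43 RULINGS 80 (c) and 84 (b): only CLOSED `Prop`s carry the open-conjecture attribute; a PARAMETRISED predicate
carrying that attribute and reached by a route item's body trips the gate's undeclared-tag readiness check, and so does a docstring of an untagged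
declaration that spells the attribute out — hence the wording here).
[cite: HoffsteinLuo1997, Theorem (§1, pp. 435–436) (such a frame exists; shape only)]
[cite: Skinner2016PacificMC, Thm. C (display shape of the `≥`-half; VOID on the rank-0 corner — nothing asserted)] -/
def CornerTwinLowerModEightAt (W : WeierstrassCurve ℚ) [W.IsElliptic] [W.IsGloballyMinimal] : Prop :=
  ClassX11b W 3 → ¬ Surj W 3 →
    ∃ (K : Type) (_ : Field K) (_ : NumberField K)
      (Wd : WeierstrassCurve ℚ) (_ : Wd.IsElliptic) (_ : Wd.IsGloballyMinimal) (Cd : VariableChange ℚ),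
      IsTwinFrame W K Wd Cd ∧ NumberField.discr K % 8 = 1 ∧
        ∃ q : ℚ, Wd.entireLFunction 1 / (Wd.realPeriodRat : ℂ) = (q : ℂ) ∧
          padicValRat 3 q ≤ (padicValNat 3 Wd.shaOrder : ℤ) + padicValNat 3 Wd.tamagawaProduct -
            2 * padicValNat 3 Wd.torsionOrder

/-- VERBATIM COPY of `CornerTwinHalves.CornerTwinLowerModEight` (lane B g6 p585727; = the r22 stub `stub_cornerTwinLowerModEight3` of
`Cruxes/CornerAtThreeW/Lines/inert.lean` = RULING 80 child #5 `CornerTwinLowerModEightAtThree`) over Theses-free imports: the class-wide form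
`∀ W, CornerTwinLowerModEightAt W` (the copy above). Beyond print class-wide (a non-vanishing-mod-`3` statement for ONE quadratic twist at a
`d ≡ 1 (mod 8)` Heegner frame); per pair certified (mult-p3 census-g5 `DH-oddN-split2-witnesses.tsv`: 61 ∕ 61 odd-`N` corner pairs `N < 5·10⁵` have an
EXACT such twin, least `|d| ≤ 1 271` — EVIDENCE, T7). A `Prop` constant; OPEN; nothing asserted; definitionally equal to the original.
[cite: HoffsteinLuo1997, Theorem (§1) (shape only)] [cite: Miller2011LMS, Def. 1.1] -/
@[conjecture]
def CornerTwinLowerModEight : Prop :=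
  ∀ (W : WeierstrassCurve ℚ) [W.IsElliptic] [W.IsGloballyMinimal], CornerTwinLowerModEightAt W

end Summit.BirchSwinnertonDyer.BirchSwinnertonDyer.Theorems.R23Items

end
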